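import Summits.BirchSwinnertonDyer.BirchSwinnertonDyer.Theorems.GenusKolyvaginAtTwoVisiblePairAtTwoInjective
import Summits.BirchSwinnertonDyer.BirchSwinnertonDyer.Theorems.GenusKolyvaginAtTwoVisiblePairAtTwoInstanceDefs
import Literature.NumberTheory.EllipticCurves.HeegnerPointsKolyvaginVisibleDescentPairExactProofs
import Literature.NumberTheory.EllipticCurves.SelmerFiniteProofs
import Literature.NumberTheory.EllipticCurves.HeegnerPointsKolyvaginVisibleDescentPairExactTorsionProofs
import HarnessLib

/-!
# Route `GenusKolyvaginAtTwo`, LINE 6, KEY crux Q3 (inner statement of stmt-BirchSwinnertonDyer-22137):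
# EXACTNESS of the ℚ-pair instance `visiblePair I` from a SHALLOW certificate, with the Čebotarev inputs
# discharged (helper, PROVED modulo the displayed inputs; seat `bsd-line-gk2-p2` g11)

Capstone of this seat's bricks on seat gk2-p3's instance `visiblePair I` (p640418,
`…VisiblePairAtTwoInstanceDefs`): gk2-p2's exactness theorem
`KolyvaginDescent.VisiblePairHypothesesM.sel₁_eq_and_card_sel₂_eq_of_primitive` (McCallum Thm. 5.4 / Cor. 5.6,
case `M₁ = 0`) applied to `visiblePair I`, with

* its two-ray Čebotarev hypothesis `hCeb` DISCHARGED (`hCeb_two_rays`, p640754, read through the instance's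
  `part = pairEig`, `A = a₁ × a₂`, `rK`, `Kol = kolPrime` by `rfl`), and
* its DEEP certificate (`Kol ℓ₀`, `2^{M−1}·c₂ ℓ₀ ≠ 0`) PRODUCED from a SHALLOW one by the deepening step
  (`exists_kolPrime_pow_zsmul_ne_zero_of_ne_zero`, p643292: McCallum Prop. 5.2 for `r = 1` with Čebotarev,
  reciprocity, local duality and the injectivity of `ι` discharged).

Result `selmer_eq_and_card_selmer_twin_eq_of_shallow`:
**`Sel^{(2^M)}(E/ℚ) = ℤx` and `#Sel^{(2^M)}(E^{(d_K)}/ℚ) = 4^{M₀}`**, CONDITIONAL on: the inputs `I` (classes with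
descent identities, Q2 over `K`, Lemma 4.3 over `ℚ`, (H2), Cor. 3.2 — the last now a theorem, `input_cebotarev`);
the Cassels–Tate inputs `P₁`, `P₂`, `hCTV` and Lemma 4.3 in the form `hcsupp₁/₂` of the exactness theorem; `3M₀ ≤ M`;
and the level-`2` data of the shallow certificate (prime `ℓ₀`, `c_1(ℓ₀) ≠ 0`, auxiliary class, `c_1(ℓ₀ℓ)`, `c_1(ℓ)`
with Lemma 4.3 / Prop. 4.4 at `λ`, `λ₀`, visibility of the embedded pair, the Lemma 4.6 identity). Nothing about
BSD, Q2, (H2) or the Cassels–Tate value formula is proved here.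

References: [McCallumLMS1991] §1 Theorem, p. 287, Prop. 5.2, Thm. 5.4, Cor. 5.6; [Kolyvagin1989Izv] §3.
-/

set_option autoImplicit false
set_option linter.dupNamespace false -- tree convention: `Summit.BirchSwinnertonDyer.BirchSwinnertonDyer.Theorems` (summit = sub-problem)

noncomputable section

open scoped Classical

namespace Summit.BirchSwinnertonDyer.BirchSwinnertonDyer.Theorems.GenusExact.VisiblePairAtTwo

open WeierstrassCurve NumberField IsDedekindDomain Field Finset Rat.HeightOneSpectrum
open Literature.NumberTheory.EllipticCurves Literature.NumberTheory.GaloisRepresentations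
open Literature.NumberTheory.EllipticCurves.KolyvaginDescent

variable {W : WeierstrassCurve ℚ} [W.IsElliptic] [W.IsGloballyMinimal] {K : Type} [Field K] [NumberField K]
  {M : ℕ} {θ : K} {hθ : θ ∉ Set.range (algebraMap ℚ K)}
  {hθsq : θ ^ 2 = algebraMap ℚ K ((NumberField.discr K : ℤ) : ℚ)}

/-- Membership in the parts `pairEig` of a pair: `ν = ±1` gives purity `g.2 = 0 ∨ g.1 = 0`. [folklore] -/
theorem snd_eq_zero_or_fst_eq_zero_of_mem_pairEig {V₁ V₂ : Type*} [AddCommGroup V₁] [AddCommGroup V₂]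
    {ν : ℤ} (hν : ν = 1 ∨ ν = -1) {g : V₁ × V₂} (hg : g ∈ pairEig V₁ V₂ ν) : g.2 = 0 ∨ g.1 = 0 := by
  rcases hν with rfl | rfl
  · left
    simpa [pairEig, AddSubgroup.mem_prod] using hg
  · right
    simpa [pairEig, AddSubgroup.mem_prod] using hg

/-- **The two-ray `hCeb` of the exactness theorem for `visiblePair I`, PROVED** (`hCeb_two_rays` read through the
instance). [cite: McCallumLMS1991, Prop. 3.1 with §3 (2)–(3); §5 (21)–(23)] -/
theorem hCeb_visiblePair (I : Input W K M hθ hθsq) (hcm : ¬ W.HasCM) (hΔ : W.Δ < 0)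
    (hK : IsImaginaryQuadratic K) (hodd : Odd (NumberField.discr K))
    (hns : ¬ IsSquare ((NumberField.discr K : ℚ) * -|W.Δ|))
    (hρ : ∀ n : ℕ, W.HasSurjectiveModNGaloisRep (2 ^ n : ℕ)) [(twin W K).IsElliptic] (hM : 1 ≤ M) :
    ∀ (T : Finset (galH1Torsion W (lvl M) × galH1Torsion (twin W K) (lvl M)))
      (g₁ g₂ : galH1Torsion W (lvl M) × galH1Torsion (twin W K) (lvl M)) (ν : ℤ), (ν = 1 ∨ ν = -1) →
      g₁ ∈ (visiblePair I).toVisibleSplit.part ν → g₂ ∈ (visiblePair I).toVisibleSplit.part (-ν) →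
      (∀ t ∈ T, ∃ e : ℤ, (e = 1 ∨ e = -1) ∧ t ∈ (visiblePair I).toVisibleSplit.part e) →
      (∀ g ∈ AddSubgroup.closure (insert g₁ (insert g₂ (T : Set _))),
        (visiblePair I).rK₁ g.1 + (visiblePair I).rK₂ g.2 = 0 → g = 0) →
      ∀ b : ℕ, ∃ ℓ, b < ℓ ∧ (visiblePair I).Kol ℓ ∧
        (∀ t ∈ T, t ∈ ((visiblePair I).A₁ ℓ).prod ((visiblePair I).A₂ ℓ)) ∧
        (∀ j : ℕ, (((visiblePair I).p : ℤ) ^ j) • g₁ ∈ ((visiblePair I).A₁ ℓ).prod ((visiblePair I).A₂ ℓ) ↔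
          (((visiblePair I).p : ℤ) ^ j) • g₁ ∈ AddSubgroup.closure (T : Set _)) ∧
        (∀ j : ℕ, (((visiblePair I).p : ℤ) ^ j) • g₂ ∈ ((visiblePair I).A₁ ℓ).prod ((visiblePair I).A₂ ℓ) ↔
          (((visiblePair I).p : ℤ) ^ j) • g₂ ∈ AddSubgroup.closure (T : Set _)) := by
  intro T g₁ g₂ ν hν hg₁ hg₂ hT hinj b
  have hν' : -ν = 1 ∨ -ν = -1 := by rcases hν with rfl | rfl <;> simp
  obtain ⟨ℓ, hbℓ, hkol, hTin, hr₁, hr₂⟩ := hCeb_two_rays W K M hθ hθsq hcm hΔ hK hodd hns hρ hM T g₁ g₂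
    (snd_eq_zero_or_fst_eq_zero_of_mem_pairEig hν hg₁)
    (snd_eq_zero_or_fst_eq_zero_of_mem_pairEig hν' hg₂)
    (fun t ht ↦ by
      obtain ⟨e, he, hte⟩ := hT t ht
      exact snd_eq_zero_or_fst_eq_zero_of_mem_pairEig he hte)
    hinj b
  refine ⟨ℓ, hbℓ, hkol, hTin, fun j ↦ ?_, fun j ↦ ?_⟩
  · have h := hr₁ j
    change ((2 : ℕ) : ℤ) ^ j • g₁ ∈ _ ↔ ((2 : ℕ) : ℤ) ^ j • g₁ ∈ _
    rw [Nat.cast_ofNat]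
    exact h
  · have h := hr₂ j
    change ((2 : ℕ) : ℤ) ^ j • g₂ ∈ _ ↔ ((2 : ℕ) : ℤ) ^ j • g₂ ∈ _
    rw [Nat.cast_ofNat]
    exact h

/-- **The visibility input `hvis` of the deepening IS the habitat condition (H2) when the auxiliary class is
Selmer**: for `u ∈ Sel^{(2)}(E/ℚ)`, `y₀ ∈ Sel^{(2)}(E^{(d_K)}/ℚ)` the embedded classes `ι u`, `ι y₀` are Selmer at
level `2^M` (`torsionH1OfDvd_mem_selmerGroup`), so `Input.sel_visible` gives the termwise triviality of every relation
`rK₁ (a₁ ι u) + rK₂ (a₂ ι y₀) = 0`. [cite: GrossLMS1991, Prop. 9.1] [cite: McCallumLMS1991, p. 299] -/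
theorem hvis_of_sel_visible (I : Input W K M hθ hθsq) (hM : 1 ≤ M) {u : galH1Torsion W (lvl 1)}
    {y₀ : galH1Torsion (twin W K) (lvl 1)} (hu : u ∈ selmerGroup W (lvl 1))
    (hy : y₀ ∈ selmerGroup (twin W K) (lvl 1)) :
    ∀ a₁' a₂' : ℤ, rK₁ W K M (a₁' • torsionH1OfDvd W (lvl_one_dvd_lvl hM) u) +
      rK₂ W M hθ hθsq (a₂' • torsionH1OfDvd (twin W K) (lvl_one_dvd_lvl hM) y₀) = 0 →
      a₁' • torsionH1OfDvd W (lvl_one_dvd_lvl hM) u = 0 ∧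
        a₂' • torsionH1OfDvd (twin W K) (lvl_one_dvd_lvl hM) y₀ = 0 :=
  fun a₁' a₂' h ↦ I.sel_visible _
    (AddSubgroup.zsmul_mem _ (torsionH1OfDvd_mem_selmerGroup W (lvl_one_dvd_lvl hM) hu) a₁') _
    (AddSubgroup.zsmul_mem _ (torsionH1OfDvd_mem_selmerGroup (twin W K) (lvl_one_dvd_lvl hM) hy) a₂') h

/-- **Exactness of the ℚ-pair at `2` from a SHALLOW certificate, Čebotarev inputs discharged.** For the inputs
`I` of the instance on the LINE-6 habitat (`E` globally minimal non-CM, `Δ < 0`, `ρ_{E,2^n}` onto, `K = ℚ(θ)`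
imaginary quadratic, `θ² = d_K` odd, `d_K·(−|Δ|)` not a square, `1 ≤ M`, `3M₀ ≤ M`), Cassels–Tate inputs
`P₁` (on `Sel^{(2^M)}(E/ℚ)`: alternating, vanishing against `x`, non-degenerate modulo `ℤx`), `P₂` (on
`Sel^{(2^M)}(E^{(d_K)}/ℚ)`: alternating, non-degenerate) with the value formula `hCTV`, Lemma 4.3 for the classes
(`hcsupp₁/₂`), and the level-`2` data of a shallow depth-one certificate at a prime `ℓ₀` (`c_1(ℓ₀) ≠ 0`, an
auxiliary class `u ≠ 0` Selmer off `ℓ₀`, `c_1(ℓ₀ℓ)`, `c_1(ℓ)` with Lemma 4.3 / Prop. 4.4 at `λ` and `λ₀`, the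
visibility of `{ι u, ι c_1(ℓ₀)}`, the Lemma 4.6 identity `ι c_1(ℓ) = 2^{M−1} c₂(ℓ)`):
**`Sel^{(2^M)}(E/ℚ) = ℤx` and `#Sel^{(2^M)}(E^{(d_K)}/ℚ) = 2^{2M₀}`** — at `2` for the visible pair:
`Ш(E/ℚ)_{2^M} = 0` and `#Ш(E^{(d_K)}/ℚ)_{2^M} = 4^{M₀}`. [cite: McCallumLMS1991, §1 Theorem, p. 287, Prop. 5.2, Thm. 5.4, Cor. 5.6]
[cite: Kolyvagin1989Izv, §3] -/
theorem selmer_eq_and_card_selmer_twin_eq_of_shallow (I : Input W K M hθ hθsq) (hcm : ¬ W.HasCM)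
    (hΔ : W.Δ < 0) (hK : IsImaginaryQuadratic K) (hodd : Odd (NumberField.discr K))
    (hns : ¬ IsSquare ((NumberField.discr K : ℚ) * -|W.Δ|))
    (hρ : ∀ n : ℕ, W.HasSurjectiveModNGaloisRep (2 ^ n : ℕ)) [(twin W K).IsElliptic] (hM : 1 ≤ M)
    -- Cassels–Tate inputs and Lemma 4.3, in the currency of the exactness theorem
    (P₁ : (visiblePair I).Sel₁ →+ (visiblePair I).Sel₁ →+ AddCircle (1 : ℚ)) (halt₁ : ∀ z, P₁ z z = 0)
    (hPx : ∀ t, P₁ ⟨(visiblePair I).x, (visiblePair I).x_mem⟩ t = 0)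
    (hnd₁ : ∀ z : (visiblePair I).Sel₁, (∀ t, P₁ z t = 0) →
      (z : galH1Torsion W (lvl M)) ∈ AddSubgroup.zmultiples (visiblePair I).x)
    (P₂ : (visiblePair I).Sel₂ →+ (visiblePair I).Sel₂ →+ AddCircle (1 : ℚ)) (halt₂ : ∀ z, P₂ z z = 0)
    (hnd₂ : ∀ z : (visiblePair I).Sel₂, (∀ t, P₂ z t = 0) → z = 0)
    (hCTV : ∀ ℓ m : ℕ, (visiblePair I).Kol ℓ → KolSupp (visiblePair I).Kol (ℓ * m) → ¬ ℓ ∣ m →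
      ∀ (j N a b : ℕ) (t : galH1Torsion W (lvl M) × galH1Torsion (twin W K) (lvl M))
        (ht : t ∈ (visiblePair I).toVisibleSplit.Sel)
        (hz : (((visiblePair I).p : ℤ) ^ j) • (visiblePair I).toVisibleSplit.c (ℓ * m) ∈
          (visiblePair I).toVisibleSplit.Sel),
      (((visiblePair I).p : ℤ) ^ N) • t = 0 →
      t ∈ (visiblePair I).toVisibleSplit.part (1 * (-1) ^ (ℓ * m).primeFactors.card) →
      (∀ q ∈ m.primeFactors, t ∈ (visiblePair I).toVisibleSplit.A q) →
      (visiblePair I).M - (visiblePair I).M₀ ≤ j → N + (visiblePair I).M₀ ≤ (visiblePair I).M → N ≤ j →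
      a + b + 1 = N →
      (((visiblePair I).p : ℤ) ^ (a + (j - N))) • (visiblePair I).toVisibleSplit.c m ∉
        (visiblePair I).toVisibleSplit.A ℓ →
      (((visiblePair I).p : ℤ) ^ b) • t ∉ (visiblePair I).toVisibleSplit.A ℓ →
      (visiblePair I).prodPairing P₁ P₂ ⟨_, hz⟩ ⟨t, ht⟩ ≠ 0)
    (hcsupp₁ : ∀ n, KolSupp (visiblePair I).Kol n → Even n.primeFactors.card →
      ∀ v, (∀ q, (visiblePair I).Kol q → v ≠ (visiblePair I).pl q) → (visiblePair I).c₁ n ∈ (visiblePair I).Loc₁ v)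
    (hcsupp₂ : ∀ n, KolSupp (visiblePair I).Kol n → Odd n.primeFactors.card →
      ∀ v, (∀ q, (visiblePair I).Kol q → v ≠ (visiblePair I).pl q) → (visiblePair I).c₂ n ∈ (visiblePair I).Loc₂ v)
    (h3 : 3 * I.M₀ ≤ M)
    -- the shallow certificate and its level-`2` data
    {ℓ₀ : ℕ} (hℓ₀ : ℓ₀.Prime) (y₀ : galH1Torsion (twin W K) (lvl 1)) (hy0 : y₀ ≠ 0)
    (u : galH1Torsion W (lvl 1)) (hu0 : u ≠ 0) (hu : ∀ v, v ≠ pl ℓ₀ → u ∈ loc₁ W 1 v)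
    (uu : ℕ → galH1Torsion W (lvl 1)) (w : ℕ → galH1Torsion (twin W K) (lvl 1))
    (h43 : ∀ ℓ, kolPrime W K M ℓ → ℓ ≠ ℓ₀ → ∀ v, v ≠ pl ℓ₀ → v ≠ pl ℓ → uu ℓ ∈ loc₁ W 1 v)
    (h44sel : ∀ ℓ, kolPrime W K M ℓ → ℓ ≠ ℓ₀ → (uu ℓ ∈ loc₁ W 1 (pl ℓ) ↔ y₀ ∈ a₂ W K 1 ℓ))
    (h44ord : ∀ ℓ, kolPrime W K M ℓ → ℓ ≠ ℓ₀ → (uu ℓ ∈ a₁ W 1 ℓ₀ ↔ w ℓ ∈ a₂ W K 1 ℓ₀))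
    (hvis : ∀ a₁' a₂' : ℤ, rK₁ W K M (a₁' • torsionH1OfDvd W (lvl_one_dvd_lvl hM) u) +
      rK₂ W M hθ hθsq (a₂' • torsionH1OfDvd (twin W K) (lvl_one_dvd_lvl hM) y₀) = 0 →
      a₁' • torsionH1OfDvd W (lvl_one_dvd_lvl hM) u = 0 ∧
        a₂' • torsionH1OfDvd (twin W K) (lvl_one_dvd_lvl hM) y₀ = 0)
    (hι : ∀ ℓ, kolPrime W K M ℓ →
      torsionH1OfDvd (twin W K) (lvl_one_dvd_lvl hM) (w ℓ) = ((2 : ℤ) ^ (M - 1)) • I.c₂ ℓ) :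
    selmerGroup W (lvl M) = AddSubgroup.zmultiples I.x ∧
      Nat.card (selmerGroup (twin W K) (lvl M)) = 2 ^ (2 * I.M₀) := by
  haveI : Finite (visiblePair I).Sel₁ :=
    W.finite_selmerGroup_holds (n := lvl M) (by unfold lvl; positivity)
  haveI : Finite (visiblePair I).Sel₂ :=
    (twin W K).finite_selmerGroup_holds (n := lvl M) (by unfold lvl; positivity)
  -- the deep certificate from the shallow one
  obtain ⟨ℓ, hkol, hc₀⟩ := exists_kolPrime_pow_zsmul_ne_zero_of_ne_zero W K M hθ hθsq hcm hΔ hK hodd hns hρ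
    hM hℓ₀ y₀ hy0 u hu0 hu uu w h43 h44sel h44ord hvis I.c₂ hι
  have hc₀' : (((visiblePair I).p : ℤ) ^ ((visiblePair I).M - 1)) • (visiblePair I).c₂ ℓ ≠ 0 := by
    change ((2 : ℕ) : ℤ) ^ (M - 1) • I.c₂ ℓ ≠ 0
    rw [Nat.cast_ofNat]
    exact hc₀
  exact (visiblePair I).sel₁_eq_and_card_sel₂_eq_of_primitive P₁ halt₁ hPx hnd₁ P₂ halt₂ hnd₂ hCTV
    (hCeb_visiblePair I hcm hΔ hK hodd hns hρ hM) hcsupp₁ hcsupp₂ h3 hkol hc₀'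

/-! ### The same capstone with the value formula restricted to `2^{2M₀}`-torsion classes

Appended by seat `bsd-line-gk2-p2` g12: `selmer_eq_and_card_selmer_twin_eq_of_shallow` VERBATIM, with `hCTV` assumed only for `t` with
`2^{2M₀} t = 0` — the only classes the telescope applies it to (Selmer eigenclasses independent of `x`,
Literature `exists_chain_of_casselsTate_of_torsion`), and the form in which the Cassels–Tate pairings pulled
back to `Sel_{2^M}` actually satisfy it. -/

/-- **`selmer_eq_and_card_selmer_twin_eq_of_shallow`, value formula on `2^{2M₀}`-torsion classes only** (extra antecedent
`2^{2M₀} t = 0` in `hCTV`; everything else verbatim). [cite: McCallumLMS1991, Prop. 5.2, Thm. 5.4, Cor. 5.6]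
[cite: Kolyvagin1989Izv, §3] -/
theorem selmer_eq_and_card_selmer_twin_eq_of_shallow_of_torsion (I : Input W K M hθ hθsq) (hcm : ¬ W.HasCM)
    (hΔ : W.Δ < 0) (hK : IsImaginaryQuadratic K) (hodd : Odd (NumberField.discr K))
    (hns : ¬ IsSquare ((NumberField.discr K : ℚ) * -|W.Δ|))
    (hρ : ∀ n : ℕ, W.HasSurjectiveModNGaloisRep (2 ^ n : ℕ)) [(twin W K).IsElliptic] (hM : 1 ≤ M)
    -- Cassels–Tate inputs and Lemma 4.3, in the currency of the exactness theorem
    (P₁ : (visiblePair I).Sel₁ →+ (visiblePair I).Sel₁ →+ AddCircle (1 : ℚ)) (halt₁ : ∀ z, P₁ z z = 0)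
    (hPx : ∀ t, P₁ ⟨(visiblePair I).x, (visiblePair I).x_mem⟩ t = 0)
    (hnd₁ : ∀ z : (visiblePair I).Sel₁, (∀ t, P₁ z t = 0) →
      (z : galH1Torsion W (lvl M)) ∈ AddSubgroup.zmultiples (visiblePair I).x)
    (P₂ : (visiblePair I).Sel₂ →+ (visiblePair I).Sel₂ →+ AddCircle (1 : ℚ)) (halt₂ : ∀ z, P₂ z z = 0)
    (hnd₂ : ∀ z : (visiblePair I).Sel₂, (∀ t, P₂ z t = 0) → z = 0)
    (hCTV : ∀ ℓ m : ℕ, (visiblePair I).Kol ℓ → KolSupp (visiblePair I).Kol (ℓ * m) → ¬ ℓ ∣ m →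
      ∀ (j N a b : ℕ) (t : galH1Torsion W (lvl M) × galH1Torsion (twin W K) (lvl M))
        (ht : t ∈ (visiblePair I).toVisibleSplit.Sel)
        (hz : (((visiblePair I).p : ℤ) ^ j) • (visiblePair I).toVisibleSplit.c (ℓ * m) ∈
          (visiblePair I).toVisibleSplit.Sel),
      (((visiblePair I).p : ℤ) ^ N) • t = 0 → (((visiblePair I).p : ℤ) ^ (2 * (visiblePair I).M₀)) • t = 0 →
      t ∈ (visiblePair I).toVisibleSplit.part (1 * (-1) ^ (ℓ * m).primeFactors.card) →
      (∀ q ∈ m.primeFactors, t ∈ (visiblePair I).toVisibleSplit.A q) →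
      (visiblePair I).M - (visiblePair I).M₀ ≤ j → N + (visiblePair I).M₀ ≤ (visiblePair I).M → N ≤ j →
      a + b + 1 = N →
      (((visiblePair I).p : ℤ) ^ (a + (j - N))) • (visiblePair I).toVisibleSplit.c m ∉
        (visiblePair I).toVisibleSplit.A ℓ →
      (((visiblePair I).p : ℤ) ^ b) • t ∉ (visiblePair I).toVisibleSplit.A ℓ →
      (visiblePair I).prodPairing P₁ P₂ ⟨_, hz⟩ ⟨t, ht⟩ ≠ 0)
    (hcsupp₁ : ∀ n, KolSupp (visiblePair I).Kol n → Even n.primeFactors.card →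
      ∀ v, (∀ q, (visiblePair I).Kol q → v ≠ (visiblePair I).pl q) → (visiblePair I).c₁ n ∈ (visiblePair I).Loc₁ v)
    (hcsupp₂ : ∀ n, KolSupp (visiblePair I).Kol n → Odd n.primeFactors.card →
      ∀ v, (∀ q, (visiblePair I).Kol q → v ≠ (visiblePair I).pl q) → (visiblePair I).c₂ n ∈ (visiblePair I).Loc₂ v)
    (h3 : 3 * I.M₀ ≤ M)
    -- the shallow certificate and its level-`2` data
    {ℓ₀ : ℕ} (hℓ₀ : ℓ₀.Prime) (y₀ : galH1Torsion (twin W K) (lvl 1)) (hy0 : y₀ ≠ 0)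
    (u : galH1Torsion W (lvl 1)) (hu0 : u ≠ 0) (hu : ∀ v, v ≠ pl ℓ₀ → u ∈ loc₁ W 1 v)
    (uu : ℕ → galH1Torsion W (lvl 1)) (w : ℕ → galH1Torsion (twin W K) (lvl 1))
    (h43 : ∀ ℓ, kolPrime W K M ℓ → ℓ ≠ ℓ₀ → ∀ v, v ≠ pl ℓ₀ → v ≠ pl ℓ → uu ℓ ∈ loc₁ W 1 v)
    (h44sel : ∀ ℓ, kolPrime W K M ℓ → ℓ ≠ ℓ₀ → (uu ℓ ∈ loc₁ W 1 (pl ℓ) ↔ y₀ ∈ a₂ W K 1 ℓ))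
    (h44ord : ∀ ℓ, kolPrime W K M ℓ → ℓ ≠ ℓ₀ → (uu ℓ ∈ a₁ W 1 ℓ₀ ↔ w ℓ ∈ a₂ W K 1 ℓ₀))
    (hvis : ∀ a₁' a₂' : ℤ, rK₁ W K M (a₁' • torsionH1OfDvd W (lvl_one_dvd_lvl hM) u) +
      rK₂ W M hθ hθsq (a₂' • torsionH1OfDvd (twin W K) (lvl_one_dvd_lvl hM) y₀) = 0 →
      a₁' • torsionH1OfDvd W (lvl_one_dvd_lvl hM) u = 0 ∧
        a₂' • torsionH1OfDvd (twin W K) (lvl_one_dvd_lvl hM) y₀ = 0)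
    (hι : ∀ ℓ, kolPrime W K M ℓ →
      torsionH1OfDvd (twin W K) (lvl_one_dvd_lvl hM) (w ℓ) = ((2 : ℤ) ^ (M - 1)) • I.c₂ ℓ) :
    selmerGroup W (lvl M) = AddSubgroup.zmultiples I.x ∧
      Nat.card (selmerGroup (twin W K) (lvl M)) = 2 ^ (2 * I.M₀) := by
  haveI : Finite (visiblePair I).Sel₁ :=
    W.finite_selmerGroup_holds (n := lvl M) (by unfold lvl; positivity)
  haveI : Finite (visiblePair I).Sel₂ :=
    (twin W K).finite_selmerGroup_holds (n := lvl M) (by unfold lvl; positivity)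
  -- the deep certificate from the shallow one
  obtain ⟨ℓ, hkol, hc₀⟩ := exists_kolPrime_pow_zsmul_ne_zero_of_ne_zero W K M hθ hθsq hcm hΔ hK hodd hns hρ
    hM hℓ₀ y₀ hy0 u hu0 hu uu w h43 h44sel h44ord hvis I.c₂ hι
  have hc₀' : (((visiblePair I).p : ℤ) ^ ((visiblePair I).M - 1)) • (visiblePair I).c₂ ℓ ≠ 0 := by
    change ((2 : ℕ) : ℤ) ^ (M - 1) • I.c₂ ℓ ≠ 0
    rw [Nat.cast_ofNat]
    exact hc₀
  exact (visiblePair I).sel₁_eq_and_card_sel₂_eq_of_primitive_of_torsion P₁ halt₁ hPx hnd₁ P₂ halt₂ hnd₂ hCTV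
    (hCeb_visiblePair I hcm hΔ hK hodd hns hρ hM) hcsupp₁ hcsupp₂ h3 hkol hc₀'

end Summit.BirchSwinnertonDyer.BirchSwinnertonDyer.Theorems.GenusExact.VisiblePairAtTwo

end
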